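import Mathlib
import HarnessLib
import Summits.ValiantsHypothesis.ValiantsHypothesis.Theorems.LacunarySymmetroidMatrixDescartesProductPlusOneRowTowerKDefs

/-!
# LINE (A) `product_plus_one` — the θ-tower of a K-nomial row to ORDER 8: `ψ₄ … ψ₇` (definitions only)

Continuation of ✓ `…RowTowerKDefs` (`rowHK`, `rowUK`, `rowPsiK0…3` for the stripped row `A − Σ_l B_l x^{λ_l}`).  With `θ = x·d/dx`, `θH_k = H_{k+1}` and
`θu = H₁u²`, the higher slopes `ψ_{k+1} := θψ_k` are explicit polynomials in `H₁,…,H_{k+2}` and `u` (generated by that derivation rule from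
`ψ₁ = H₂u + H₁²u²`; equivalently `ψ_k = −κ_{k+2}` of the unit-mass rate distribution of ✓ `…RowTowerKCumulant`, moments `m_i = −H_iu`).  They are the
currency the pen asked for (memo §30.7, C5): for `Λ(t) = t³ − e₁t² + e₂t − e₃`, `Λ(θ²)ψ₁ = ψ₇ − e₁ψ₅ + e₂ψ₃ − e₃ψ₁` is an explicit function of the tower for
EVERY support size (trinomials included).  The derivative chain `θψ_k = ψ_{k+1}` (k = 3…6) is ✓/⧗ `…RowTowerKCalculus8`.

Honest framing: definitions only; nothing closes; 18050 / `MatrixDescartes` OPEN; `VP ≠ VNP` NOT proved.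
-/

set_option linter.dupNamespace false

namespace Summit.ValiantsHypothesis.ValiantsHypothesis.Theorems.LacunarySymmetroidMatrixDescartes

namespace ProductPlusOne

open Finset
open scoped BigOperators

variable {n : ℕ}

/-- `ψ₄ = θψ₃` (7 monomials in `H₁…H₅`, `u`; `= −κ₆` of the rate distribution). -/
noncomputable def rowPsiK4 (lam : Fin n → ℕ) (A : ℝ) (B : Fin n → ℝ) (x : ℝ) : ℝ :=
    1 * (rowHK lam 5 B x * rowUK lam A B x) +
      10 * (rowHK lam 2 B x * rowHK lam 3 B x * rowUK lam A B x ^ 2) +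
      5 * (rowHK lam 1 B x * rowHK lam 4 B x * rowUK lam A B x ^ 2) +
      30 * (rowHK lam 1 B x * rowHK lam 2 B x ^ 2 * rowUK lam A B x ^ 3) +
      20 * (rowHK lam 1 B x ^ 2 * rowHK lam 3 B x * rowUK lam A B x ^ 3) +
      60 * (rowHK lam 1 B x ^ 3 * rowHK lam 2 B x * rowUK lam A B x ^ 4) +
      24 * (rowHK lam 1 B x ^ 5 * rowUK lam A B x ^ 5)

/-- `ψ₅ = θψ₄` (11 monomials in `H₁…H₆`, `u`; `= −κ₇` of the rate distribution). -/
noncomputable def rowPsiK5 (lam : Fin n → ℕ) (A : ℝ) (B : Fin n → ℝ) (x : ℝ) : ℝ :=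
    1 * (rowHK lam 6 B x * rowUK lam A B x) +
      10 * (rowHK lam 3 B x ^ 2 * rowUK lam A B x ^ 2) +
      15 * (rowHK lam 2 B x * rowHK lam 4 B x * rowUK lam A B x ^ 2) +
      6 * (rowHK lam 1 B x * rowHK lam 5 B x * rowUK lam A B x ^ 2) +
      30 * (rowHK lam 2 B x ^ 3 * rowUK lam A B x ^ 3) +
      120 * (rowHK lam 1 B x * rowHK lam 2 B x * rowHK lam 3 B x * rowUK lam A B x ^ 3) +
      30 * (rowHK lam 1 B x ^ 2 * rowHK lam 4 B x * rowUK lam A B x ^ 3) +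
      270 * (rowHK lam 1 B x ^ 2 * rowHK lam 2 B x ^ 2 * rowUK lam A B x ^ 4) +
      120 * (rowHK lam 1 B x ^ 3 * rowHK lam 3 B x * rowUK lam A B x ^ 4) +
      360 * (rowHK lam 1 B x ^ 4 * rowHK lam 2 B x * rowUK lam A B x ^ 5) +
      120 * (rowHK lam 1 B x ^ 6 * rowUK lam A B x ^ 6)

/-- `ψ₆ = θψ₅` (15 monomials in `H₁…H₇`, `u`; `= −κ₈` of the rate distribution). -/
noncomputable def rowPsiK6 (lam : Fin n → ℕ) (A : ℝ) (B : Fin n → ℝ) (x : ℝ) : ℝ :=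
    1 * (rowHK lam 7 B x * rowUK lam A B x) +
      35 * (rowHK lam 3 B x * rowHK lam 4 B x * rowUK lam A B x ^ 2) +
      21 * (rowHK lam 2 B x * rowHK lam 5 B x * rowUK lam A B x ^ 2) +
      7 * (rowHK lam 1 B x * rowHK lam 6 B x * rowUK lam A B x ^ 2) +
      210 * (rowHK lam 2 B x ^ 2 * rowHK lam 3 B x * rowUK lam A B x ^ 3) +
      140 * (rowHK lam 1 B x * rowHK lam 3 B x ^ 2 * rowUK lam A B x ^ 3) +
      210 * (rowHK lam 1 B x * rowHK lam 2 B x * rowHK lam 4 B x * rowUK lam A B x ^ 3) +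
      42 * (rowHK lam 1 B x ^ 2 * rowHK lam 5 B x * rowUK lam A B x ^ 3) +
      630 * (rowHK lam 1 B x * rowHK lam 2 B x ^ 3 * rowUK lam A B x ^ 4) +
      1260 * (rowHK lam 1 B x ^ 2 * rowHK lam 2 B x * rowHK lam 3 B x * rowUK lam A B x ^ 4) +
      210 * (rowHK lam 1 B x ^ 3 * rowHK lam 4 B x * rowUK lam A B x ^ 4) +
      2520 * (rowHK lam 1 B x ^ 3 * rowHK lam 2 B x ^ 2 * rowUK lam A B x ^ 5) +
      840 * (rowHK lam 1 B x ^ 4 * rowHK lam 3 B x * rowUK lam A B x ^ 5) +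
      2520 * (rowHK lam 1 B x ^ 5 * rowHK lam 2 B x * rowUK lam A B x ^ 6) +
      720 * (rowHK lam 1 B x ^ 7 * rowUK lam A B x ^ 7)

/-- `ψ₇ = θψ₆` (22 monomials in `H₁…H₈`, `u`; `= −κ₉` of the rate distribution). -/
noncomputable def rowPsiK7 (lam : Fin n → ℕ) (A : ℝ) (B : Fin n → ℝ) (x : ℝ) : ℝ :=
    1 * (rowHK lam 8 B x * rowUK lam A B x) +
      35 * (rowHK lam 4 B x ^ 2 * rowUK lam A B x ^ 2) +
      56 * (rowHK lam 3 B x * rowHK lam 5 B x * rowUK lam A B x ^ 2) +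
      28 * (rowHK lam 2 B x * rowHK lam 6 B x * rowUK lam A B x ^ 2) +
      8 * (rowHK lam 1 B x * rowHK lam 7 B x * rowUK lam A B x ^ 2) +
      560 * (rowHK lam 2 B x * rowHK lam 3 B x ^ 2 * rowUK lam A B x ^ 3) +
      420 * (rowHK lam 2 B x ^ 2 * rowHK lam 4 B x * rowUK lam A B x ^ 3) +
      560 * (rowHK lam 1 B x * rowHK lam 3 B x * rowHK lam 4 B x * rowUK lam A B x ^ 3) +
      336 * (rowHK lam 1 B x * rowHK lam 2 B x * rowHK lam 5 B x * rowUK lam A B x ^ 3) +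
      56 * (rowHK lam 1 B x ^ 2 * rowHK lam 6 B x * rowUK lam A B x ^ 3) +
      630 * (rowHK lam 2 B x ^ 4 * rowUK lam A B x ^ 4) +
      5040 * (rowHK lam 1 B x * rowHK lam 2 B x ^ 2 * rowHK lam 3 B x * rowUK lam A B x ^ 4) +
      1680 * (rowHK lam 1 B x ^ 2 * rowHK lam 3 B x ^ 2 * rowUK lam A B x ^ 4) +
      2520 * (rowHK lam 1 B x ^ 2 * rowHK lam 2 B x * rowHK lam 4 B x * rowUK lam A B x ^ 4) +
      336 * (rowHK lam 1 B x ^ 3 * rowHK lam 5 B x * rowUK lam A B x ^ 4) +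
      10080 * (rowHK lam 1 B x ^ 2 * rowHK lam 2 B x ^ 3 * rowUK lam A B x ^ 5) +
      13440 * (rowHK lam 1 B x ^ 3 * rowHK lam 2 B x * rowHK lam 3 B x * rowUK lam A B x ^ 5) +
      1680 * (rowHK lam 1 B x ^ 4 * rowHK lam 4 B x * rowUK lam A B x ^ 5) +
      25200 * (rowHK lam 1 B x ^ 4 * rowHK lam 2 B x ^ 2 * rowUK lam A B x ^ 6) +
      6720 * (rowHK lam 1 B x ^ 5 * rowHK lam 3 B x * rowUK lam A B x ^ 6) +
      20160 * (rowHK lam 1 B x ^ 6 * rowHK lam 2 B x * rowUK lam A B x ^ 7) +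
      5040 * (rowHK lam 1 B x ^ 8 * rowUK lam A B x ^ 8)

end ProductPlusOne

end Summit.ValiantsHypothesis.ValiantsHypothesis.Theorems.LacunarySymmetroidMatrixDescartes
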